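import Summits.CriticalPhenomena.PercolationContinuityZ3.Theorems.PercNearOneGluingNoHeavyLowerTailSahiCombMixFiveSingle

/-!
# The comb hierarchy for Sahi's `E_k`, XCVIII: comb H-MIX(5), `|G| = 4` — the slots of the rows (preliminaries for the assembly `…SahiCombMixFourOfFive`)

Support file of the one-cut programme (crux `NoHeavyLowerTail`, stmt-CriticalPhenomena-4575; cell `prim-masterthm`, seat P3, gen 12;
`run/shared/lean/prim/prim-masterthm/prim-masterthm-p3/HIERARCHY.md` §20).  With `G4 = (T,T,T,T,F)` (the coordinate `e` OR-ed into members `0,1,2,3`, member `4` untouched):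
`orCoord_G4_of_ne/four`, `biInter_orCoord_G4_of_notMem`, **`biInter_orCoord_G4`** (`⋂_{l∈K} orCoord U e G4 l = ((⋂_{K∖4} U) ∪ [e]) ∩ [4∈K] U_4`), and the two slot lemmas
`slotG4_in/out` identifying every slot with a PATTERN slot `{t,4}` / `{t}` of the derived quintuple `W′` (`W′_t = ⋂_{K∖4} U`, `W′_4 = U_4`).
HONEST FRAMING: set algebra; nothing here asserts (M⁺-k) or `C_k` for `k ≥ 3`. [this work]
-/

noncomputable section

open scoped Classical

namespace Summit.CriticalPhenomena.PercolationContinuityZ3.Theorems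

open Finset Function
open SahiCombDisjunct (orCoord)

variable {ι : Type} [Fintype ι]

namespace SahiCombMix

/-! ### The selector `G4` (all members but `4`) and the slots of its rows -/

omit [Fintype ι] in
/-- Touched members: `orCoord U e G4 l = U_l ∪ {e ∈ ω}` for `l ≠ 4`. [this work] -/
theorem orCoord_G4_of_ne (U : Fin 5 → Set (Set ι)) (e : ι) {l : Fin 5} (hl : l ≠ 4) :
    orCoord U e (![true, true, true, true, false] : Fin 5 → Bool) l = U l ∪ {ω : Set ι | e ∈ ω} := by
  fin_cases l <;> first | rfl | exact absurd rfl hl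

omit [Fintype ι] in
/-- The untouched member: `orCoord U e G4 4 = U_4`. [this work] -/
theorem orCoord_G4_four (U : Fin 5 → Set (Set ι)) (e : ι) :
    orCoord U e (![true, true, true, true, false] : Fin 5 → Bool) 4 = U 4 := rfl

omit [Fintype ι] in
/-- Over an index set avoiding `4`: `⋂_{l∈L}(U_l ∪ [e]) = (⋂_{l∈L} U_l) ∪ [e]`. [this work] -/
theorem biInter_orCoord_G4_of_notMem (U : Fin 5 → Set (Set ι)) (e : ι) (L : Finset (Fin 5)) (hL : (4 : Fin 5) ∉ L) :
    (⋂ l ∈ L, orCoord U e (![true, true, true, true, false] : Fin 5 → Bool) l) = (⋂ l ∈ L, U l) ∪ {ω : Set ι | e ∈ ω} := by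
  have hne : ∀ l ∈ L, l ≠ (4 : Fin 5) := fun l hl h4 => hL (h4 ▸ hl)
  ext ω
  simp only [Set.mem_iInter, Set.mem_union, Set.mem_setOf_eq]
  constructor
  · intro h
    by_cases he : e ∈ ω
    · exact Or.inr he
    · refine Or.inl fun l hl => ?_
      have h' := h l hl
      rw [orCoord_G4_of_ne U e (hne l hl)] at h'
      exact h'.resolve_right he
  · rintro (h | h) l hl
    · rw [orCoord_G4_of_ne U e (hne l hl)]; exact Or.inl (h l hl)
    · rw [orCoord_G4_of_ne U e (hne l hl)]; exact Or.inr h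

omit [Fintype ι] in
/-- **Slots of the rows of `orCoord U e G4`**: `⋂_{l∈K} = ((⋂_{l∈K∖4} U_l) ∪ [e]) ∩ [4 ∈ K] U_4`. [this work] -/
theorem biInter_orCoord_G4 (U : Fin 5 → Set (Set ι)) (e : ι) (K : Finset (Fin 5)) :
    (⋂ l ∈ K, orCoord U e (![true, true, true, true, false] : Fin 5 → Bool) l)
      = ((⋂ l ∈ K.erase 4, U l) ∪ {ω : Set ι | e ∈ ω}) ∩ (if (4 : Fin 5) ∈ K then U 4 else Set.univ) := by
  by_cases h4 : (4 : Fin 5) ∈ K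
  · rw [if_pos h4]
    conv_lhs => rw [← Finset.insert_erase h4]
    rw [Finset.set_biInter_insert, biInter_orCoord_G4_of_notMem U e _ (Finset.notMem_erase 4 K), orCoord_G4_four, Set.inter_comm]
  · rw [if_neg h4, Set.inter_univ, biInter_orCoord_G4_of_notMem U e K h4, Finset.erase_eq_of_notMem h4]

omit [Fintype ι] in
/-- A slot containing the untouched member, over the derived family `W′` (`W′_4 = U_4`, `W′_t = ⋂_{K∖4} U`): it is the pattern slot `{t, 4}`. [this work] -/
theorem slotG4_in (U W' : Fin 5 → Set (Set ι)) (e : ι) (K : Finset (Fin 5)) (hK : (4 : Fin 5) ∈ K) (t : Fin 5) (ht : t ≠ 4)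
    (h4 : W' 4 = U 4) (ht' : W' t = ⋂ l ∈ K.erase 4, U l) :
    (⋂ l ∈ K, orCoord U e (![true, true, true, true, false] : Fin 5 → Bool) l)
      = ⋂ l ∈ ({t, 4} : Finset (Fin 5)), orCoord W' e (![true, true, true, true, false] : Fin 5 → Bool) l := by
  rw [biInter_orCoord_G4 U e K, if_pos hK, biInter_orCoord_G4 W' e, if_pos (by simp), Finset.erase_insert_of_ne ht,
    Finset.erase_singleton, Finset.insert_empty, Finset.set_biInter_singleton, ht', h4]

omit [Fintype ι] in
/-- A slot avoiding the untouched member, over the derived family: it is the pattern slot `{t}`. [this work] -/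
theorem slotG4_out (U W' : Fin 5 → Set (Set ι)) (e : ι) (K : Finset (Fin 5)) (hK : (4 : Fin 5) ∉ K) (t : Fin 5) (ht : t ≠ 4)
    (ht' : W' t = ⋂ l ∈ K.erase 4, U l) :
    (⋂ l ∈ K, orCoord U e (![true, true, true, true, false] : Fin 5 → Bool) l)
      = ⋂ l ∈ ({t} : Finset (Fin 5)), orCoord W' e (![true, true, true, true, false] : Fin 5 → Bool) l := by
  have h4t : (4 : Fin 5) ∉ ({t} : Finset (Fin 5)) := by rw [Finset.mem_singleton]; exact fun h => ht h.symm
  rw [biInter_orCoord_G4 U e K, if_neg hK, Set.inter_univ, biInter_orCoord_G4 W' e, if_neg h4t, Set.inter_univ,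
    Finset.erase_eq_of_notMem h4t, Finset.set_biInter_singleton, ht']

omit [Fintype ι] in
/-- Relabelling by `π = swap u 4`: `orCoord (U ∘ π) e G4 = (orCoord U e (G4 ∘ π)) ∘ π`. [this work] -/
theorem orCoord_swap_G4 (U : Fin 5 → Set (Set ι)) (e : ι) (u : Fin 5) :
    orCoord (U ∘ (Equiv.swap u 4)) e (![true, true, true, true, false] : Fin 5 → Bool)
      = (orCoord U e ((![true, true, true, true, false] : Fin 5 → Bool) ∘ (Equiv.swap u 4))) ∘ (Equiv.swap u 4) := by
  funext l
  have h : orCoord (U ∘ (Equiv.swap u 4)) e (((![true, true, true, true, false] : Fin 5 → Bool) ∘ (Equiv.swap u 4)) ∘ (Equiv.swap u 4)) l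
      = orCoord U e ((![true, true, true, true, false] : Fin 5 → Bool) ∘ (Equiv.swap u 4)) ((Equiv.swap u 4) l) := rfl
  rw [show (((![true, true, true, true, false] : Fin 5 → Bool) ∘ ⇑(Equiv.swap u 4)) ∘ ⇑(Equiv.swap u 4))
      = (![true, true, true, true, false] : Fin 5 → Bool) from by funext x; simp [Equiv.swap_apply_self]] at h
  exact h

/-- The selector "all members but `u`" is `G4 ∘ swap u 4`. [this work] -/
theorem allBut_eq_swap (u : Fin 5) :
    (fun j : Fin 5 => decide (j ≠ u)) = (![true, true, true, true, false] : Fin 5 → Bool) ∘ (Equiv.swap u 4) := by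
  fin_cases u <;> decide

end SahiCombMix

end Summit.CriticalPhenomena.PercolationContinuityZ3.Theorems

end
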